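import Literature.Computability.QuantumComplexity.SLPCodesExt
import Literature.Computability.QuantumComplexity.ConstEFP
import HarnessLib

/-!
# The controlled-phase program `qftPhaseB k Tre Tim` compiles in polynomial time

Topic `Literature/Computability/QuantumComplexity`; the S4 compiler input of the UNIFORMITY of Regev's sampler ([Regev2009,
Lemma 3.14, proof]; Nielsen–Chuang §5.1): the classical program of the dyadic controlled phase of the pair `(j, l)` of the Fourier
stage is `QFTWord.prog k j l = SLP.qftPhaseB k (cosThr m k) (sinThr m k)` (`QFTBlockWord.lean`). We write `qftPhaseB k Tre Tim` as the
instance of ONE parametric program `AJLCore.qftPhasePBX : PBX 2` with external leaves (`SLPCodesExt.lean`) at the context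
`c = (k, Tre, Tim)` — the two external arithmetic leaves are the constants `constE (k+1) Tre`, `constE (k+1) Tim`, compiled on codes by
`SLP.constE_compile_codeFP` (`ConstEFP.lean`) — and conclude

* `SLP.constE_compile_indep` — the compiled constant does not depend on the width;
* mirrors `AJLCore.zeroPAX`, `aPAX`, `bitPBX`, `truePBX`, `thr0PBX`, `itePBX`, `phaseSignPBX`, `qftCtlPBX`, **`qftPhasePBX`**, the leaves
  `AJLCore.qftA`, `AJLCore.qftA_codeFP`, **`AJLCore.inst_qftPhasePBX : qftPhasePBX.inst Prod.fst qftA c = qftPhaseB c.1 c.2.1 c.2.2`**;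
* **`SLP.qftPhaseB_compile_codeFP : CodeFP (1ᵏ, bin Tre, bin Tim) ↦ (qftPhaseB k Tre Tim).compile (thrWd k) 0 0`**.

Everything is proved; no named fact is introduced.

## References

* O. Regev, J. ACM 56(6) (2009), Lemma 3.14 (proof) [Regev2009].
* M. A. Nielsen, I. L. Chuang, *Quantum Computation and Quantum Information*, CUP 2010, §5.1 [NielsenChuang2010].
* S. Arora, B. Barak, *Computational Complexity: A Modern Approach*, CUP 2009, §1.3, §6.2 [AroraBarak2009].
-/

noncomputable section

namespace Literature.Computability.QuantumComplexity

open _root_.Computability Complexity Complexity.CodeFP SLP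

/-- The compiled constant does not depend on the width. [folklore] -/
theorem SLP.constE_compile_indep (Wd Wd' w T r : ℕ) : (constE w T).compile Wd r = (constE w T).compile Wd' r := by
  rw [constE_compile_eq, constE_compile_eq]

namespace AJLCore

section MirrorsX

variable {m : ℕ}

/-- `0`. [folklore] -/
def zeroPAX : PAX m := .fld (0, 0, 0) (0, 0, 0)
/-- the averaging field `a`. [folklore] -/
def aPAX : PAX m := .fld (0, 0, 0) (1, 0, 0)
/-- the bit at a truncated-affine offset. [folklore] -/
def bitPBX (off : Aff3) : PBX m := .lt zeroPAX (.fld off (0, 1, 0))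
/-- `true`. [folklore] -/
def truePBX (f : Aff3) : PBX m := .or (bitPBX f) (.not (bitPBX f))
/-- `T₀`. [folklore] -/
def thr0PBX : PBX m := .lt (.add zeroPAX aPAX (0, 1, 0)) (.pw (1, 0, 0))
/-- `if c then x else y`. [folklore] -/
def itePBX (c x y : PBX m) : PBX m := .or (.and c x) (.and (.not c) y)
/-- the phase sign predicate. [folklore] -/
def phaseSignPBX (ctl pre pim : PBX m) : PBX m := itePBX ctl (itePBX (bitPBX (1, 0, 0)) pim pre) (itePBX (bitPBX (1, 0, 0)) thr0PBX (truePBX (1, 0, 0)))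
/-- the QFT control `conjB (k+2) [true, true]`. [folklore] -/
def qftCtlPBX : PBX m := .and (bitPBX (1, 2, 0)) (bitPBX (1, 3, 0))

/-- **The parametric controlled-phase program**: leaves `0` (real threshold) and `1` (imaginary threshold).
[cite: NielsenChuang2010, §5.1] -/
def qftPhasePBX : PBX 2 := phaseSignPBX qftCtlPBX (.lt aPAX (.ext 0)) (.lt aPAX (.ext 1))

/-- The external leaves at the context `(k, Tre, Tim)`: `constE (k+1) Tre`, `constE (k+1) Tim`. [folklore] -/
def qftA (j : Fin 2) (c : ℕ × ℕ × ℕ) : AExpr := constE (c.1 + 1) (if (j : ℕ) = 0 then c.2.1 else c.2.2)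

/-- The context code `(1ᵏ, bin Tre, bin Tim)`. [folklore] -/
abbrev qftCtxE : ℕ × ℕ × ℕ → List Bool := pairE unE (pairE natE natE)

/-- The external leaves compile on codes. [folklore] -/
theorem qftA_codeFP (j : Fin 2) : CodeFP (inAX qftCtxE) outAE (fun t => (qftA j t.1).compile (thrWd t.1.1) t.2) := by
  have hT : CodeFP (inAX qftCtxE) natE (fun t => if (j : ℕ) = 0 then t.1.2.1 else t.1.2.2) := by
    by_cases hj : (j : ℕ) = 0
    · exact ((fst _ _).snd'.fst' :).congr fun t => by rw [if_pos hj]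
    · exact ((fst _ _).snd'.snd' :).congr fun t => by rw [if_neg hj]
  exact (((constE_compile_codeFP 0).comp ((unSucc.comp (fst _ _).fst').pair (hT.pair (snd _ _)))) :).congr fun t => by
    show (constE _ _).compile 0 _ = _; rw [qftA, constE_compile_indep 0 (thrWd t.1.1)]

variable (c : ℕ × ℕ × ℕ)

attribute [local simp] PAX.inst PBX.inst Aff3.ev Nat.zero_mul Nat.one_mul Nat.zero_add Nat.add_zero Nat.sub_zero

/-- [folklore] -/ @[simp] theorem inst_zeroPAX : (zeroPAX : PAX 2).inst Prod.fst qftA c = zeroE := by simp [zeroPAX, zeroE]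
/-- [folklore] -/ @[simp] theorem inst_aPAX : (aPAX : PAX 2).inst Prod.fst qftA c = aE c.1 := by simp [aPAX, aE]
/-- [folklore] -/ @[simp] theorem inst_bitPBX (f : Aff3) : (bitPBX f : PBX 2).inst Prod.fst qftA c = bitB (f.ev c.1) := by simp [bitPBX, bitB, zeroPAX, zeroE]
/-- [folklore] -/ @[simp] theorem inst_truePBX (f : Aff3) : (truePBX f : PBX 2).inst Prod.fst qftA c = trueB (f.ev c.1) := by simp [truePBX, trueB]
/-- [folklore] -/ @[simp] theorem inst_thr0PBX : (thr0PBX : PBX 2).inst Prod.fst qftA c = thr0B c.1 := by simp [thr0PBX, thr0B, shlE]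
/-- [folklore] -/ @[simp] theorem inst_itePBX (b x y : PBX 2) :
    (itePBX b x y).inst Prod.fst qftA c = iteB (b.inst Prod.fst qftA c) (x.inst Prod.fst qftA c) (y.inst Prod.fst qftA c) := by simp [itePBX, iteB]
/-- [folklore] -/ @[simp] theorem inst_phaseSignPBX (b x y : PBX 2) :
    (phaseSignPBX b x y).inst Prod.fst qftA c = phaseSignB c.1 (b.inst Prod.fst qftA c) (x.inst Prod.fst qftA c) (y.inst Prod.fst qftA c) := by
  simp [phaseSignPBX, phaseSignB]
/-- [folklore] -/ @[simp] theorem inst_qftCtlPBX : (qftCtlPBX : PBX 2).inst Prod.fst qftA c = qftCtlB c.1 := by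
  simp [qftCtlPBX, qftCtlB, conjB, litB]
/-- **The parametric controlled-phase program is the controlled-phase program.** [cite: NielsenChuang2010, §5.1] -/
@[simp] theorem inst_qftPhasePBX : qftPhasePBX.inst Prod.fst qftA c = qftPhaseB c.1 c.2.1 c.2.2 := by
  simp [qftPhasePBX, qftPhaseB, ltConstB, qftA]

end MirrorsX

end AJLCore

/-- **`(1ᵏ, bin Tre, bin Tim) ↦ (qftPhaseB k Tre Tim).compile (thrWd k) 0 0` in polynomial time.** [cite: Regev2009, Lemma 3.14 (proof)]
[cite: AroraBarak2009, §6.2 (proof of Thm. 6.15)] -/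
theorem SLP.qftPhaseB_compile_codeFP :
    CodeFP AJLCore.qftCtxE AJLCore.outBE (fun c => (qftPhaseB c.1 c.2.1 c.2.2).compile (thrWd c.1) 0 0) :=
  (AJLCore.PBX.compile_inst_codeFP (fst _ _) AJLCore.qftA_codeFP AJLCore.qftPhasePBX).congr fun c => by
    rw [AJLCore.inst_qftPhasePBX]

end Literature.Computability.QuantumComplexity

end
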